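import Literature.Geometry.Riemannian.ChangGurskyYangRegularity
import Literature.Geometry.Lorentzian.MetricNormSq
import HarnessLib

/-!
# `R² ≤ 4|Ric|²_g` pointwise for a Riemannian metric in dimension four
(stub `stub_scalarCurvature_sq_le` of line `cgy-variance-pivot`, crux
`EntropyRung.CompactShrinkerGap`, item stmt-SmoothPoincare4-10870)

For a Riemannian metric `g` (Levi-Civita connection) on a `4`-manifold `M`, at every point
`x ∈ M` the scalar curvature `R(x) = tr_g Ric` and the metric square norm
`|Ric|²_g(x) = Ric_{ij} Ric^{ij}` (`normSq`) satisfy the trace Cauchy–Schwarz inequality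
`R(x)² ≤ 4 · |Ric|²_g(x)` (equivalently `|Ric − (R/4) g|² ≥ 0`; equality iff `g` is Einstein at
`x`). This is the pointwise trace bound entering the Cheng–Ribeiro–Zhou estimate
`∫(R − 2)² ≤ ½(e^c ∫e^{-f} − Vol)` for compact four-dimensional gradient shrinkers
(Cheng–Ribeiro–Zhou, Lemma 1 and Theorem 1; Cao–Zhu, (3.6)–(3.7)).

Proof (pure fibrewise linear algebra, no differentiation): pick a `g_x`-orthonormal basis
`b : Fin 4 → T_x M` (`exists_basis_isOrthonormalFrame`, `finrank ℝ ℝ⁴ = 4`); the frame formula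
`normSq_eq_sum_sq` gives `|Ric|² = Σᵢⱼ Ric(bⱼ, bᵢ)²` (`g(bᵢ, bᵢ) = 1`), and
`Σᵢ Ric(bᵢ, bᵢ) = R` (`IsOrthonormalFrame.sum_ricci_eq_scalarCurvature`). Dropping the
off-diagonal squares, `Σᵢⱼ Ric(bⱼ, bᵢ)² ≥ Σᵢ Ric(bᵢ, bᵢ)²` (`Finset.single_le_sum`), and the
finite Cauchy–Schwarz inequality on `Fin 4`, `(Σᵢ aᵢ)² ≤ 4 Σᵢ aᵢ²`
(`sq_sum_le_card_mul_sum_sq`), conclude. Everything used is proved in tree; no definition, no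
named fact. Check: round `S⁴(√6)`: `Ric = g/2`, `|Ric|² = 1`, `R = 2`: `4 ≤ 4` (equality, as
the round sphere is Einstein).

References: X. Cheng, E. Ribeiro Jr, D. Zhou, arXiv:2203.14916, Lemma 1 [ChengRibeiroZhou2022];
H.-D. Cao, M. Zhu, arXiv:1008.0842, (3.6)–(3.7) [CaoZhu2010]; B. O'Neill, *Semi-Riemannian
geometry* (1983), Ch. 3, pp. 60–61 (metric contraction in a frame) [ONeill1983].
-/

noncomputable section

-- the registered namespace `Summit.SmoothPoincare4.SmoothPoincare4.Theorems` repeats a component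
set_option linter.dupNamespace false

open Bundle Set Function Filter Module MeasureTheory
open scoped Manifold ContDiff Topology

namespace Summit.SmoothPoincare4.SmoothPoincare4.Theorems

open Literature.Geometry Literature.Geometry.Lorentzian Literature.Geometry.Riemannian
  Literature.Geometry.Lorentzian.PseudoRiemannianMetric

/-- **STUB `stub_scalarCurvature_sq_le` of line `cgy-variance-pivot` — the pointwise trace
Cauchy–Schwarz inequality for the Ricci tensor in dimension four.** For a Riemannian `g`
(Levi-Civita) on a `4`-manifold: `R² ≤ 4|Ric|²_g` at every point (`R = tr_g Ric`, the metric
square norm `normSq = T_{ij}T^{ij}` is computed in a `g_x`-orthonormal basis by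
`normSq_eq_sum_sq`, `exists_basis_isOrthonormalFrame`,
`IsOrthonormalFrame.sum_ricci_eq_scalarCurvature`; then drop the off-diagonal squares and apply
`(Σᵢ aᵢ)² ≤ 4 Σᵢ aᵢ²` on `Fin 4`). Check: round `S⁴(√6)`: `R = 2`, `|Ric|² = 1`, `4 ≤ 4`.
[folklore] -/
theorem stub_scalarCurvature_sq_le :
    ∀ (M : Type) [TopologicalSpace M] [T2Space M] [SecondCountableTopology M]
      [ChartedSpace (EuclideanSpace ℝ (Fin 4)) M] [IsManifold (𝓡 4) ∞ M]
      (g : Literature.Geometry.Lorentzian.PseudoRiemannianMetric (𝓡 4) ∞ (EuclideanSpace ℝ (Fin 4))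
        (TangentSpace (𝓡 4) : M → Type _)) [g.HasLeviCivita], g.IsRiemannian →
      ∀ x : M, g.scalarCurvature x ^ 2 ≤ 4 * g.normSq x (g.ricci x) := by
  intro M _ _ _ _ _ g _ hg x
  have hE : finrank ℝ (EuclideanSpace ℝ (Fin 4)) = 4 := finrank_euclideanSpace_fin
  -- a `g_x`-orthonormal basis of `T_x M`
  obtain ⟨b, hb⟩ := g.exists_basis_isOrthonormalFrame (x := x) (fun v hv ↦ hg x v hv) hE
  have hO : (g.toBilinForm x).IsOrthoᵢ b := fun i j hij ↦ hb.2 i j hij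
  have hc : ∀ i, g.val x (b i) (b i) ≠ 0 := fun i ↦ by
    rw [hb.1 i]
    exact one_ne_zero
  rw [g.normSq_eq_sum_sq x b hO hc (g.ricci x), ← hb.sum_ricci_eq_scalarCurvature g hE]
  simp only [hb.1, mul_one, div_one]
  -- drop the off-diagonal squares: `Σᵢ Ric(bᵢ, bᵢ)² ≤ Σᵢⱼ Ric(bⱼ, bᵢ)²`
  have hdiag : ∑ i, g.ricci x (b i) (b i) ^ 2 ≤ ∑ i, ∑ j, g.ricci x (b j) (b i) ^ 2 :=
    Finset.sum_le_sum fun i _ ↦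
      Finset.single_le_sum (f := fun j ↦ g.ricci x (b j) (b i) ^ 2) (fun j _ ↦ sq_nonneg _)
        (Finset.mem_univ i)
  -- Cauchy–Schwarz on `Fin 4`: `(Σᵢ aᵢ)² ≤ 4 Σᵢ aᵢ²`
  have hcs := sq_sum_le_card_mul_sum_sq (s := (Finset.univ : Finset (Fin 4)))
    (f := fun i ↦ g.ricci x (b i) (b i))
  simp only [Finset.card_univ, Fintype.card_fin, Nat.cast_ofNat] at hcs
  linarith

end Summit.SmoothPoincare4.SmoothPoincare4.Theorems

end
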